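import Mathlib
import Literature.AlgebraicGeometry.Resolution.OrderFlatLocalHom
import Literature.AlgebraicGeometry.Resolution.ArtinApproximationAffineLemmas
import Literature.AlgebraicGeometry.Resolution.RegularHomReduced
import Literature.AlgebraicGeometry.Resolution.RegularFormalFibres
import Literature.AlgebraicGeometry.Resolution.AdicNoetherian
import HarnessLib

/-!
# Orders along a formal branch of a G-ring are attained on the algebraic branch below it

Topic: `Literature/AlgebraicGeometry/Resolution`. The "excellence" half of the "standard
arguments" in the termination proof of Cossart–Piltant 2008, Prop. 4.4 (p. 11: "`Γ` is a formal
branch of an irreducible component of `Σ(i₁)` passing through `x(i₁)`: a contradiction, since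
`{x_{σ(i₁)}}` is an isolated point of `Σ`"): for a local G-ring `(R, 𝔪)` (e.g. a local ring of a
quasi-excellent scheme), an ideal `J ⊆ R`, and a prime `𝔓` of the completion `R^` with
`J R^ ⊆ 𝔓^μ`, the prime `𝔮 = 𝔓 ∩ R` has **`J R_𝔮 ⊆ 𝔮^μ R_𝔮`**, i.e. `ord_𝔮(J) ≥ μ`
(`map_le_pow_maximalIdeal_localization_under`). Indeed `R_𝔮 → (R^)_𝔓` is a flat local
homomorphism whose closed fibre is a local ring of the formal fibre `κ(𝔮) ⊗_R R^`, regular by the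
G-ring property, so orders are preserved (`OrderFlatLocalHom.lean`).

* `isRegularLocalRing_quotient_of_isRegularRing_fiber` — the local rings `B_𝔔/𝔭B_𝔔` of a
  regular fibre ring `κ(𝔭) ⊗_A B` are regular;
* `map_le_pow_maximalIdeal_localization_under` — the theorem above.

## Sources

* V. Cossart, O. Piltant, J. Algebra 320 (2008), proof of Prop. 4.4, p. 11. [CossartPiltant2008]
* H. Matsumura, *Commutative Ring Theory* (1986), §32, p. 256 (G-rings). [Matsumura1987]
-/

noncomputable section

open IsLocalRing TensorProduct

namespace Literature.AlgebraicGeometry.Resolution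

universe u

/-! ## Local rings of a regular fibre ring -/

/-- **The closed fibres `B_𝔔/𝔭B_𝔔` at the primes `𝔔` over `𝔭` of an algebra with regular fibre
ring `κ(𝔭) ⊗_A B` are regular local rings** (they are the local rings of the fibre ring,
Mathlib's `Ideal.Fiber.localizationAlgEquivQuotient`). [cite: Matsumura1987, §32 p. 255] -/
theorem isRegularLocalRing_quotient_of_isRegularRing_fiber {A B : Type u} [CommRing A]
    [CommRing B] [Algebra A B] [IsNoetherianRing B] (Q : Ideal B) [Q.IsPrime]
    (hF : IsRegularRing ((Q.under A).Fiber B)) :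
    IsRegularLocalRing
      (Localization.AtPrime Q ⧸ (Q.under A).map (algebraMap A (Localization.AtPrime Q))) := by
  set p : Ideal A := Q.under A with hp
  let q : PrimeSpectrum (p.Fiber B) :=
    PrimeSpectrum.primesOverOrderIsoFiber A B p ⟨Q, inferInstance, inferInstance⟩
  have hq : q.asIdeal.comap (Algebra.TensorProduct.includeRight : B →ₐ[A] p.Fiber B) = Q := by
    have h1 := PrimeSpectrum.coe_primesOverOrderIsoFiber_symm_apply (R := A) (S := B) p q
    rw [OrderIso.symm_apply_apply] at h1
    exact h1.symm
  haveI : IsRegularLocalRing (Localization.AtPrime q.asIdeal) :=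
    IsRegularRing.isRegularLocalRing_localization q.asIdeal
  set r : Ideal B := q.asIdeal.comap (Algebra.TensorProduct.includeRight : B →ₐ[A] p.Fiber B)
    with hr
  have hrp : r.under A = p := by rw [hq]
  haveI : r.LiesOver p := ⟨hrp.symm⟩
  letI : Algebra (Localization.AtPrime p) (Localization.AtPrime r) :=
    Localization.AtPrime.algebraOfLiesOver p r
  haveI hreg : IsRegularLocalRing
      (Localization.AtPrime r ⧸ p.map (algebraMap A (Localization.AtPrime r))) :=
    IsRegularLocalRing.of_ringEquiv (R := Localization.AtPrime q.asIdeal)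
      (Ideal.Fiber.localizationAlgEquivQuotient p q.asIdeal).toRingEquiv
  -- transport from `r` to `Q` (equal ideals)
  have hM : r.primeCompl = Q.primeCompl := by
    ext x; change x ∉ r ↔ x ∉ Q; rw [hq]
  haveI : IsLocalization.AtPrime (Localization.AtPrime Q) r := by
    change IsLocalization r.primeCompl _
    rw [hM]
    exact Localization.isLocalization
  let e : Localization.AtPrime r ≃ₐ[B] Localization.AtPrime Q :=
    IsLocalization.algEquiv r.primeCompl _ _
  have he : (p.map (algebraMap A (Localization.AtPrime Q))) =
      (p.map (algebraMap A (Localization.AtPrime r))).map (e : _ →+* Localization.AtPrime Q) := by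
    rw [Ideal.map_map]
    congr 1
    ext a
    change algebraMap A (Localization.AtPrime Q) a = e (algebraMap A (Localization.AtPrime r) a)
    rw [IsScalarTower.algebraMap_apply A B (Localization.AtPrime r),
      IsScalarTower.algebraMap_apply A B (Localization.AtPrime Q)]
    exact (e.commutes _).symm
  exact IsRegularLocalRing.of_ringEquiv (Ideal.quotientEquiv _ _ e.toRingEquiv he)

/-! ## Orders along formal branches -/

section GRing

variable {R : Type u} [CommRing R] [IsLocalRing R] [IsNoetherianRing R]

local notation "R^" => AdicCompletion (maximalIdeal R) R

/-- **`ord_𝔮(J) ≥ μ` for the algebraic branch `𝔮 = 𝔓 ∩ R` below a formal prime `𝔓` with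
`J R^ ⊆ 𝔓^μ`**, for a local G-ring `R`: `J R_𝔮 ⊆ (𝔮 R_𝔮)^μ`. (`R_𝔮 → (R^)_𝔓` is flat local
with regular closed fibre by the G-ring property; `OrderFlatLocalHom.lean`.)
[cite: CossartPiltant2008, proof of Prop. 4.4, p. 11] [cite: Matsumura1987, §32 p. 256] -/
theorem map_le_pow_maximalIdeal_localization_under (hG : IsGRing R) (J : Ideal R) (μ : ℕ)
    (𝔓 : Ideal R^) [𝔓.IsPrime] (hJ : J.map (algebraMap R R^) ≤ 𝔓 ^ μ) :
    J.map (algebraMap R (Localization.AtPrime (𝔓.under R))) ≤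
      maximalIdeal (Localization.AtPrime (𝔓.under R)) ^ μ := by
  set 𝔮 : Ideal R := 𝔓.under R with h𝔮
  set A := Localization.AtPrime 𝔮
  set B := Localization.AtPrime 𝔓
  -- the flat local homomorphism `A = R_𝔮 → B = (R^)_𝔓`
  haveI : 𝔓.LiesOver 𝔮 := ⟨rfl⟩
  letI : Algebra A B := Localization.AtPrime.algebraOfLiesOver 𝔮 𝔓
  have halg : algebraMap A B = Localization.localRingHom 𝔮 𝔓 (algebraMap R R^) Ideal.LiesOver.over :=
    Localization.AtPrime.IsLiesOverAlgebra.algebraMap_eq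
  haveI : IsLocalHom (algebraMap A B) := by rw [halg]; infer_instance
  haveI : IsNoetherianRing R^ := isNoetherianRing_adicCompletion_maximalIdeal R
  haveI : IsLocalization.AtPrime R (maximalIdeal R) :=
    IsLocalization.of_le_isUnit fun x hx => by
      change IsUnit x
      have hx' : x ∉ maximalIdeal R := hx
      exact not_not.mp fun h => hx' ((mem_maximalIdeal x).mpr h)
  haveI : IsNoetherianRing A := inferInstance
  haveI : IsNoetherianRing B := inferInstance
  haveI : Module.Flat R B := Module.Flat.trans R R^ B
  haveI : Module.Flat A B :=
    (Module.flat_iff_of_isLocalization (S := A) 𝔮.primeCompl (M := B)).mpr inferInstance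
  -- its closed fibre is a local ring of the formal fibre over `𝔮`, regular as `R` is a G-ring
  have hRH : IsRegularHom R R^ :=
    hG.isRegularHom_completion_of_isLocalization_atPrime (maximalIdeal R) R
  have hF : IsRegularRing (𝔮.Fiber R^) := hRH.isRegularRing_fiber 𝔮
  have hreg₀ := isRegularLocalRing_quotient_of_isRegularRing_fiber (A := R) (B := R^) 𝔓 hF
  have hmax : (maximalIdeal A).map (algebraMap A B) = 𝔮.map (algebraMap R B) := by
    rw [← Localization.AtPrime.map_eq_maximalIdeal, Ideal.map_map, ← IsScalarTower.algebraMap_eq]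
  have hreg : IsRegularLocalRing (B ⧸ (maximalIdeal A).map (algebraMap A B)) := by
    rw [hmax]; exact hreg₀
  -- orders are preserved along `A → B`
  rw [Ideal.map_le_iff_le_comap]
  intro f hf
  rw [Ideal.mem_comap, mem_pow_maximalIdeal_iff_of_isRegularLocalRing_fiber hreg μ]
  have h1 : algebraMap A B (algebraMap R A f) = algebraMap R^ B (algebraMap R R^ f) := by
    rw [← IsScalarTower.algebraMap_apply, IsScalarTower.algebraMap_apply R R^ B]
  rw [h1, ← Localization.AtPrime.map_eq_maximalIdeal, ← Ideal.map_pow]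
  exact Ideal.mem_map_of_mem _ (hJ (Ideal.mem_map_of_mem _ hf))

end GRing

end Literature.AlgebraicGeometry.Resolution

end
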